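import Summits.HodgeConjecture.Statement
import Summits.HodgeConjecture.HodgeConjecture.Theses.RankFourFaces
import Summits.HodgeConjecture.HodgeConjecture.Theses.PadicSemiregularLift
import Literature.AlgebraicGeometry.HodgeTheory.HodgeGroupProductSemisimpleCMFactor
import HarnessLib

/-!
# Ring 2 · route `motiv` (generation 3) — the CM-factor product theorem for `A` with SEMISIMPLE Hodge group (abelian varieties of Weil type with `Hg = SU_H` enter), by name against `HC_CM`

HONEST FRAMING: research route conditional on HC_CM; not a corollary; Q11.4-sentence-2 already refuted in dim ≥ 3.

Cell `pub-hodge-ring2`, seat `pub-hodge-ring2-motiv-g3`. SUMMIT-SIDE binding of the Literature file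
`Literature/AlgebraicGeometry/HodgeTheory/HodgeGroupProductSemisimpleCMFactor.lean` (Part III of the
CM-factor product files; Parts I–II are bound in `Theorems/Ring2MotivProductCMFactor{,Classes}.lean`,
p188311 / p188955). The hypothesis "Hodge conjecture for complex abelian varieties of CM type" is bound BY
NAME to the tree's route item `Theses.RankFourFaces.CMAbelianHodge` (it is `∀ B, Milne1999.CMHodgeHypothesisAt B`
by `Iff.rfl`); `HC_CM` is a HYPOTHESIS (a binder) of every conditional theorem — never an axiom, never
"known". `HC_AV` is the tree item `Theses.PadicSemiregularLift.HodgeAbelianVarieties`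
(stmt-HodgeConjecture-1333). The printed input — Gordon 1999 §3 / 2.16 (1) (Goursat): `Hg(B × C) =
Hg(B) × Hg(C)` when `Hg(B)` is a torus and `Hg(C)` semisimple; 2.12 (Mumford): CM ⟺ `Hg` a torus;
Moonen–Zarhin 1999 (3.1): splitting ⟹ Hodge ring of the product generated by the factors — enters as the
named fact `Gordon1999_hodgeClassesProductSpan_of_semisimple` (binder `hG`). No transport / deformation /
semiregularity is used: the Q11.4 no-go does not bear.

## Content (one-line compositions of the Literature theorems; sorry-free)

* `hodgeConjectureFor_prod_of_cmAbelianHodge_of_semisimple` — `A` with semisimple Hodge group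
  (`HasSemisimpleHodgeGroup A`: the centre of `Hg(A)(ℂ)` is finite) satisfying HC, `C` of CM type ⟹
  HC(`A × C`). Type-IV factors of `A` ALLOWED (general abelian varieties of Weil type, `Hg = SU_H`), which
  Parts I–II exclude.
* `…_of_dim_le_five_of` — `dim A ≤ 5` on Markman's claim (binder `hM`): the row of abelian FOURFOLDS OF
  WEIL TYPE times a CM factor.
* `hodgeConjectureFor_powSucc_prod_of_cmAbelianHodge_of_floccariFu` — `A^{k+1} × C`, `A` a discriminant-1
  Weil fourfold (HC of every power REFEREED: Floccari–Fu 2026 Thm. 1.2, binder `h5`), `Hg(A^{k+1})`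
  semisimple (explicit), `C` of CM type.
* `hodgeConjectureFor_prod_of_cmAbelianHodge_of_floccariFu` — the `k = 0` case (hypothesis `Hg(A)` semisimple on `A`
  itself); `hodgeConjectureFor_prod_of_floccariFu_of_dim_le_three` (+ `…_of_isIsogenous_…`) — WITHOUT `HC_CM`:
  disc-1 Weil fourfold × CM abelian variety of dimension ≤ 3 (HC(C) unconditional in the tree), up to isogeny.
* `hodgeConjectureFor_of_isIsogenous_prod_of_cmAbelianHodge_of_semisimple` — isogeny closure.
* EXACTNESS `cmAbelianHodge_iff_forall_prod_cmType_of_semisimple` — for ANY ONE `A₀` with semisimple Hodge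
  group satisfying HC, `HC_CM ⟺ (∀ C of CM type, HC(A₀ × C))` (modulo `hG`, used for `⟹` only).
* ON-PATH: `…_of_hodgeAbelianVarieties` here, and the landed `WeilTypeLadder.hodgeConjectureFor_abelianVariety_of_hodgeConjecture`
  / `HodgeTheory.hodgeConjectureFor_of_hodgeConjecture'` — every conclusion is an instance of the summit statement / of `HC_AV`.
* WITHOUT `HC_CM` (Literature, reused not restated):
  `HodgeTheory.hodgeConjectureFor_powSucc_prod_of_floccariFu_of_dim_le_three` — `A^{k+1} × C` for `C` a CM
  curve / surface / threefold, modulo the two printed facts only.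

What is NOT reached (cell RING2-MAP.md §motiv gen 3): `A × C` where `Hg(A)` has a central torus that does
not split off against `Hg(C)` (type IV with signature `p ≠ q` sharing its CM field with `C`: Moonen–Zarhin
Prop. 3.8), non-general members of Weil-type families, Abdulali's domination classes. Typed residual for
the Weil-type row: `HodgeTheory.HasSemisimpleHodgeGroup_of_hasHodgeGroupSU_statement` (finite centre of
`SU_H(ℂ)`; linear algebra, not done).

References: Gordon1999HodgeAVSurvey (1.3, 2.12, 2.16, §3 Theorem; arXiv:alg-geom/9709030 numbering);
MoonenZarhin1999LowDim (§1, §3 (3.1), Prop. 3.8); FloccariFu2026 (Thm. 1.2); Markman2025SurveySecant (Cor. 1.3,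
claim); vanGeemen1994HodgeAV (3.7, 6.12); Milne1999 (§7 (H)).
-/

set_option linter.dupNamespace false

namespace Summit.HodgeConjecture.HodgeConjecture.Ring2.Motiv

open CategoryTheory
open Literature.AlgebraicGeometry Literature.AlgebraicGeometry.Motives
open Literature.AlgebraicGeometry.HodgeTheory
open Literature.AlgebraicTopology.SingularHomology
open Summit.HodgeConjecture.HodgeConjecture.Theses

/-! ## Conditional theorems (HC_CM by name) -/

/-- **HC(A × C) from Hodge-for-CM through the CM factor, `Hg(A)` semisimple.** For complex abelian
varieties `A`, `C` with `HasSemisimpleHodgeGroup A` (finite centre of `Hg(A)(ℂ)`; type IV allowed) and `C`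
of CM type: `HC_CM` (tree item `RankFourFaces.CMAbelianHodge`, a HYPOTHESIS), the printed
splitting/generation fact `Gordon1999_hodgeClassesProductSpan_of_semisimple` (a HYPOTHESIS naming a theorem
in print) and HC for `A` give HC for `A.prod C`. `HC_CM` is used exactly once, for HC(C).
[cite: Gordon1999HodgeAVSurvey, §3 proof of the Theorem (last step) and 2.16 Proposition (1)]
[cite: MoonenZarhin1999LowDim, §3 (3.1)] -/
theorem hodgeConjectureFor_prod_of_cmAbelianHodge_of_semisimple
    (hCM : RankFourFaces.CMAbelianHodge) (hG : Gordon1999_hodgeClassesProductSpan_of_semisimple)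
    (A C : AbelianVariety ℂ) (hA : HasSemisimpleHodgeGroup A) (hCt : Milne1999.IsOfCMType C)
    (hHA : HodgeConjectureFor A.dim A.X) :
    HodgeConjectureFor (A.prod C).dim (A.prod C).X :=
  hodgeConjectureFor_prod_of_semisimple_of_cmHodgeHypothesis hCM hG A C hA hCt hHA

/-- **`dim A ≤ 5`, on the Markman claim** (the row of abelian fourfolds of Weil type × CM factor).
[claim: Markman2025SurveySecant, status: under-review] [cite: Gordon1999HodgeAVSurvey, §3 proof of the Theorem (last step)] -/
theorem hodgeConjectureFor_prod_of_cmAbelianHodge_of_semisimple_of_dim_le_five_of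
    (hCM : RankFourFaces.CMAbelianHodge) (hG : Gordon1999_hodgeClassesProductSpan_of_semisimple)
    (hM : Markman2025_hodgeClasses_algebraic_abelian_dim_le_five)
    (A C : AbelianVariety ℂ) (hA : HasSemisimpleHodgeGroup A) (hCt : Milne1999.IsOfCMType C)
    (hd : A.dim ≤ 5) :
    HodgeConjectureFor (A.prod C).dim (A.prod C).X :=
  hodgeConjectureFor_prod_of_semisimple_of_cmHodgeHypothesis_of_dim_le_five_of hM hCM hG A C hd hA hCt

/-- **Powers of a discriminant-1 Weil fourfold × CM factor** (HC of the power refereed: Floccari–Fu 2026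
Thm. 1.2, binder `h5`; semisimplicity of `Hg(A^{k+1})` explicit). [cite: FloccariFu2026, Theorem 1.2]
[cite: Gordon1999HodgeAVSurvey, §3 proof of the Theorem (last step)] -/
theorem hodgeConjectureFor_powSucc_prod_of_cmAbelianHodge_of_floccariFu
    (hCM : RankFourFaces.CMAbelianHodge) (hG : Gordon1999_hodgeClassesProductSpan_of_semisimple)
    (h5 : FloccariFu2026_hodgeClasses_algebraic_powers_discOneWeilFourfold) {d : ℕ} (hd : 0 < d)
    (A : AbelianVariety ℂ) (φ : A ⟶ A) (hA : A.dim = 2 * 2) (hφ : φ ≫ φ = -(d • 𝟙 A))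
    (e : ProjectiveEmbedding A.X) (a : complexBetti (projectiveSpace e.n ℂ) 2)
    (ha : IsRationalClass a) (ha0 : a ≠ 0)
    (hyp : IsHyperbolicWeilType A φ 2
      ((d : ℂ) • complexBetti.map e.ι 2 a + complexBetti.map φ.hom.hom.hom 2 (complexBetti.map e.ι 2 a)))
    (k : ℕ) (hAk : HasSemisimpleHodgeGroup (A.powSucc k)) (C : AbelianVariety ℂ)
    (hCt : Milne1999.IsOfCMType C) :
    HodgeConjectureFor ((A.powSucc k).prod C).dim ((A.powSucc k).prod C).X :=
  hodgeConjectureFor_powSucc_prod_of_floccariFu_of_cmHodgeHypothesis h5 hCM hG hd A φ hA hφ e a ha ha0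
    hyp k hAk C hCt

/-- **The fourfold itself (`k = 0`) × CM factor**: for `A` a discriminant-1 Weil fourfold with
`Hg(A)` semisimple (hypothesis on `A` itself: `A.powSucc 0 = A` definitionally) and `C` of CM type,
`HC_CM`, the span fact and Floccari–Fu give HC(`A × C`). [cite: FloccariFu2026, Theorem 1.2]
[cite: Gordon1999HodgeAVSurvey, §3 proof of the Theorem (last step)] -/
theorem hodgeConjectureFor_prod_of_cmAbelianHodge_of_floccariFu
    (hCM : RankFourFaces.CMAbelianHodge) (hG : Gordon1999_hodgeClassesProductSpan_of_semisimple)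
    (h5 : FloccariFu2026_hodgeClasses_algebraic_powers_discOneWeilFourfold) {d : ℕ} (hd : 0 < d)
    (A : AbelianVariety ℂ) (φ : A ⟶ A) (hA : A.dim = 2 * 2) (hφ : φ ≫ φ = -(d • 𝟙 A))
    (e : ProjectiveEmbedding A.X) (a : complexBetti (projectiveSpace e.n ℂ) 2)
    (ha : IsRationalClass a) (ha0 : a ≠ 0)
    (hyp : IsHyperbolicWeilType A φ 2
      ((d : ℂ) • complexBetti.map e.ι 2 a + complexBetti.map φ.hom.hom.hom 2 (complexBetti.map e.ι 2 a)))
    (hAs : HasSemisimpleHodgeGroup A) (C : AbelianVariety ℂ) (hCt : Milne1999.IsOfCMType C) :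
    HodgeConjectureFor (A.prod C).dim (A.prod C).X :=
  hodgeConjectureFor_powSucc_prod_of_cmAbelianHodge_of_floccariFu hCM hG h5 hd A φ hA hφ e a ha ha0 hyp 0
    hAs C hCt

/-- **WITHOUT `HC_CM`: a discriminant-1 Weil fourfold × a CM abelian variety of dimension ≤ 3.**
Hypotheses: the two printed facts (`h5` Floccari–Fu, refereed; `hG` Gordon's splitting + MZ (3.1))
and `Hg(A)` semisimple; HC(`C`) is the tree's unconditional `hodgeConjectureFor_of_dim_le_three_holds`.
An HC statement about `5`-, `6`-, `7`-dimensional abelian varieties `A × C` not verbatim in print, with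
NO summit-strength hypothesis. (`k = 0` case of the Literature theorem
`hodgeConjectureFor_powSucc_prod_of_floccariFu_of_dim_le_three`.) [cite: FloccariFu2026, Theorem 1.2]
[cite: Gordon1999HodgeAVSurvey, §3 proof of the Theorem (last step)] [cite: MoonenZarhin1999LowDim, Introduction] -/
theorem hodgeConjectureFor_prod_of_floccariFu_of_dim_le_three
    (hG : Gordon1999_hodgeClassesProductSpan_of_semisimple)
    (h5 : FloccariFu2026_hodgeClasses_algebraic_powers_discOneWeilFourfold) {d : ℕ} (hd : 0 < d)
    (A : AbelianVariety ℂ) (φ : A ⟶ A) (hA : A.dim = 2 * 2) (hφ : φ ≫ φ = -(d • 𝟙 A))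
    (e : ProjectiveEmbedding A.X) (a : complexBetti (projectiveSpace e.n ℂ) 2)
    (ha : IsRationalClass a) (ha0 : a ≠ 0)
    (hyp : IsHyperbolicWeilType A φ 2
      ((d : ℂ) • complexBetti.map e.ι 2 a + complexBetti.map φ.hom.hom.hom 2 (complexBetti.map e.ι 2 a)))
    (hAs : HasSemisimpleHodgeGroup A) (C : AbelianVariety ℂ) (hCt : Milne1999.IsOfCMType C)
    (hC3 : C.dim ≤ 3) : HodgeConjectureFor (A.prod C).dim (A.prod C).X :=
  hodgeConjectureFor_powSucc_prod_of_floccariFu_of_dim_le_three h5 hG hd A φ hA hφ e a ha ha0 hyp 0 hAs C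
    hCt hC3

/-- **WITHOUT `HC_CM`, up to isogeny**: `X` isogenous to `A × C` as in the previous theorem ⟹ HC(`X`).
[cite: vanGeemen1994HodgeAV, §3.7 Lemma 3.7 (p. 236)] [cite: FloccariFu2026, Theorem 1.2] -/
theorem hodgeConjectureFor_of_isIsogenous_prod_of_floccariFu_of_dim_le_three
    (hG : Gordon1999_hodgeClassesProductSpan_of_semisimple)
    (h5 : FloccariFu2026_hodgeClasses_algebraic_powers_discOneWeilFourfold) {d : ℕ} (hd : 0 < d)
    (A : AbelianVariety ℂ) (φ : A ⟶ A) (hA : A.dim = 2 * 2) (hφ : φ ≫ φ = -(d • 𝟙 A))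
    (e : ProjectiveEmbedding A.X) (a : complexBetti (projectiveSpace e.n ℂ) 2)
    (ha : IsRationalClass a) (ha0 : a ≠ 0)
    (hyp : IsHyperbolicWeilType A φ 2
      ((d : ℂ) • complexBetti.map e.ι 2 a + complexBetti.map φ.hom.hom.hom 2 (complexBetti.map e.ι 2 a)))
    (hAs : HasSemisimpleHodgeGroup A) (C : AbelianVariety ℂ) (hCt : Milne1999.IsOfCMType C)
    (hC3 : C.dim ≤ 3) {X : AbelianVariety ℂ} (hX : AbelianVariety.IsIsogenous X (A.prod C)) :
    HodgeConjectureFor X.dim X.X :=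
  HodgeConjectureFor.of_isIsogenous hX
    (hodgeConjectureFor_prod_of_floccariFu_of_dim_le_three hG h5 hd A φ hA hφ e a ha ha0 hyp hAs C hCt hC3)

/-- **Isogeny closure** (van Geemen Lemma 3.7, a tree theorem). [cite: vanGeemen1994HodgeAV, §3.7 Lemma 3.7 (p. 236)] -/
theorem hodgeConjectureFor_of_isIsogenous_prod_of_cmAbelianHodge_of_semisimple
    (hCM : RankFourFaces.CMAbelianHodge) (hG : Gordon1999_hodgeClassesProductSpan_of_semisimple)
    {X : AbelianVariety ℂ} (A C : AbelianVariety ℂ) (hX : AbelianVariety.IsIsogenous X (A.prod C))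
    (hA : HasSemisimpleHodgeGroup A) (hCt : Milne1999.IsOfCMType C)
    (hHA : HodgeConjectureFor A.dim A.X) : HodgeConjectureFor X.dim X.X :=
  hodgeConjectureFor_of_isIsogenous_prod_of_semisimple_of_cmHodgeHypothesis hCM hG A C hX hA hCt hHA

/-! ## Exactness: on every admissible slice, `HC_CM` is exactly the missing input -/

/-- **`HC_CM ⟺ ∀ C of CM type, HC(A₀ × C)`** for any one `A₀` with semisimple Hodge group satisfying HC
(modulo `hG`, used for `⟹` only; `⟸` is the unconditional slice `{0} × C`). [cite: Milne1999, §7 (H)]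
[cite: Gordon1999HodgeAVSurvey, §3 proof of the Theorem (last step)] -/
theorem cmAbelianHodge_iff_forall_prod_cmType_of_semisimple
    (hG : Gordon1999_hodgeClassesProductSpan_of_semisimple) (A₀ : AbelianVariety ℂ)
    (h₀ : HasSemisimpleHodgeGroup A₀) (hH₀ : HodgeConjectureFor A₀.dim A₀.X) :
    RankFourFaces.CMAbelianHodge ↔
      ∀ C : AbelianVariety ℂ, Milne1999.IsOfCMType C → HodgeConjectureFor (A₀.prod C).dim (A₀.prod C).X :=
  (forall_prod_cmType_iff_cmHodgeHypothesis_of_semisimple hG A₀ h₀ hH₀).symm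

/-! ## On-path lemmas -/

-- ON-PATH from the summit statement: every conclusion above is `HodgeConjectureFor X.dim X.X` for a
-- complex abelian variety `X`, given outright by the already-landed
-- `Summit.HodgeConjecture.HodgeConjecture.WeilTypeLadder.hodgeConjectureFor_abelianVariety_of_hodgeConjecture`
-- (Theorems/WeilTypeLadderFermatTwentyFour.lean) and by the Literature lemma
-- `HodgeTheory.hodgeConjectureFor_of_hodgeConjecture'` (p189259); not restated here (dedup).

/-- ON-PATH: every conclusion is an instance of `HC_AV` (tree item `PadicSemiregularLift.HodgeAbelianVarieties`). [folklore] -/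
theorem hodgeConjectureFor_powSucc_prod_of_hodgeAbelianVarieties
    (hAV : PadicSemiregularLift.HodgeAbelianVarieties) (A C : AbelianVariety ℂ) (k : ℕ) :
    HodgeConjectureFor ((A.powSucc k).prod C).dim ((A.powSucc k).prod C).X :=
  hAV ((A.powSucc k).prod C)

end Summit.HodgeConjecture.HodgeConjecture.Ring2.Motiv
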